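import Literature.NumberTheory.Automorphic.BianchiBoundaryEigenclass
import Literature.NumberTheory.Automorphic.BoundaryShapiro
import HarnessLib

/-!
# The Tits building of `GL₂/F` is `ℙ¹(F)`: one `GL₂(F)`-orbit, stabiliser the Borel subgroup

Topic `NumberTheory/Automorphic`; namespace `Literature.NumberTheory.Automorphic`, sub-namespace
`ParallelWeight` (as `BianchiOrdinaryClassicality`).  The poset `ProperSubspace F 2` of proper
non-zero subspaces of `F²` (the vertices of the boundary double complex of the arithmetic quotients
of `GL₂/F`, `TwistedQuotient.bdryRep`) is the projective line: every vertex is the line `F ∙ v` of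
a non-zero vector (`exists_eq_line`), `GL₂(F)` acts TRANSITIVELY (`exists_smul_lineZero_eq`:
`W = g • ∞` with `∞ = F ∙ e₀`, `g` any invertible matrix with first column spanning `W`), and the
stabiliser of `∞` is the standard BOREL subgroup of upper-triangular matrices
(`mem_stabilizer_lineZero_iff : g ∈ Stab(∞) ↔ g₁₀ = 0`).  These are the two hypotheses
(`htrans`, and the identification of `vertexStabilizer`) under which `BoundaryShapiro` identifies
the cohomology of the boundary `H^q(GL₂(F), Fun(ℙ¹(F) × GL₂(𝔸_F^∞)/U, V))` with the cohomology
`H^q(B(F), Fun(GL₂(𝔸_F^∞)/U, V))` of the Borel stratum [Harder1987, §1], [Schwermer2010, §6 (6.2)].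

## Main definitions and results

* `ParallelWeight.line F v hv : ProperSubspace F 2` — the point `[v]` of `ℙ¹(F)`.
* `ParallelWeight.lineZero F = [e₀] = ∞`; `ParallelWeight.borel F := Stab_{GL₂(F)}(∞)`.
* `exists_eq_line`, `smul_line_val`, `exists_smul_lineZero_eq` (transitivity),
  `mem_stabilizer_lineZero_iff`, `mem_borel_iff` (stabiliser = upper-triangular matrices).
* `isIso_toStratumCohomology_lineZero` — `H^q(∂, column 0) ≅ H^q(B(F), Fun(GL₂(𝔸_F^∞)/U, V_wt))`.

## References

* G. Harder, *Eisenstein cohomology of arithmetic groups. The case GL₂*, Invent. Math. 89 (1987), §1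
  [Harder1987].
* J. Schwermer, Bull. AMS 47 (2010), §6 (6.1)–(6.2), §12.2 [Schwermer2010].
-/

noncomputable section

open scoped NumberField Classical
open IsDedekindDomain

namespace Literature.NumberTheory.Automorphic

namespace ParallelWeight

section Field

variable (F : Type) [Field F]

/-! ### Points of `ℙ¹(F)` as lines -/

/-- The line `F ∙ v` of a non-zero vector `v ∈ F²`, as a vertex of the Tits building of `GL₂/F`
(a point of `ℙ¹(F)`): it is non-zero because `v ≠ 0` and proper because it has dimension `1 < 2`.
[cite: Schwermer2010, §12.2] -/
def line (v : Fin 2 → F) (hv : v ≠ 0) : ProperSubspace F 2 :=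
  ⟨F ∙ v, by rwa [Ne, Submodule.span_singleton_eq_bot], fun h => by
    have h1 : Module.finrank F (F ∙ v) = 1 := finrank_span_singleton hv
    rw [h, finrank_top, Module.finrank_fin_fun] at h1
    exact absurd h1 (by decide)⟩

/-- Unfolding lemma: the subspace underlying `line F v hv` is `F ∙ v`. [folklore] -/
@[simp]
theorem line_val (v : Fin 2 → F) (hv : v ≠ 0) : (line F v hv).1 = F ∙ v := rfl

variable {F} in
/-- Two lines are equal iff their underlying subspaces are. [folklore] -/
theorem line_eq_iff {v w : Fin 2 → F} (hv : v ≠ 0) (hw : w ≠ 0) :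
    line F v hv = line F w hw ↔ (F ∙ v) = F ∙ w :=
  ⟨fun h => congrArg Subtype.val h, fun h => Subtype.ext h⟩

/-- **Every vertex of the Tits building of `GL₂/F` is a line**: a proper non-zero subspace `W` of
`F²` is `F ∙ v` for any non-zero `v ∈ W` (`F ∙ v ≤ W` and `ℙ¹(F)` is an antichain,
`properSubspace_two_eq_of_le`). [cite: Schwermer2010, §12.2] -/
theorem exists_eq_line (W : ProperSubspace F 2) :
    ∃ (v : Fin 2 → F) (hv : v ≠ 0), W = line F v hv := by
  obtain ⟨v, hvW, hv⟩ := (Submodule.ne_bot_iff W.1).1 W.2.1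
  refine ⟨v, hv, (properSubspace_two_eq_of_le F (line F v hv) W ?_).symm⟩
  change F ∙ v ≤ W.1
  exact (Submodule.span_singleton_le_iff_mem v W.1).2 hvW

/-- The first standard basis vector `e₀ = (1, 0)` is non-zero. [folklore] -/
theorem single_zero_one_ne_zero : (Pi.single 0 1 : Fin 2 → F) ≠ 0 := fun h => by
  have := congrFun h 0
  simp at this

/-- **The base point `∞ = [e₀] = F ∙ (1, 0)` of `ℙ¹(F)`.** [cite: Harder1987, §1] -/
def lineZero : ProperSubspace F 2 :=
  line F (Pi.single 0 1) (single_zero_one_ne_zero F)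

/-- Unfolding lemma: `(∞).1 = F ∙ e₀`. [folklore] -/
@[simp]
theorem lineZero_val : (lineZero F).1 = F ∙ (Pi.single 0 1 : Fin 2 → F) := rfl

/-! ### The action of `GL₂(F)`: transitivity -/

variable {F} in
/-- An invertible matrix kills no non-zero vector. [folklore] -/
theorem mulVec_ne_zero (g : GL (Fin 2) F) {v : Fin 2 → F} (hv : v ≠ 0) :
    (g : Matrix (Fin 2) (Fin 2) F).mulVec v ≠ 0 := fun h => hv (by
  have h' := congrArg ((g⁻¹ : GL (Fin 2) F) : Matrix (Fin 2) (Fin 2) F).mulVec h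
  rwa [Matrix.mulVec_mulVec, ← Units.val_mul, inv_mul_cancel, Units.val_one, Matrix.one_mulVec,
    Matrix.mulVec_zero] at h')

variable {F} in
/-- **`g • [v] = [g v]`** on underlying subspaces: `(g • line v).1 = F ∙ (g v)`. [folklore] -/
theorem smul_line_val (g : GL (Fin 2) F) (v : Fin 2 → F) (hv : v ≠ 0) :
    (g • line F v hv).1 = F ∙ (g : Matrix (Fin 2) (Fin 2) F).mulVec v := by
  change (F ∙ v).map (Matrix.mulVecLin (g : Matrix (Fin 2) (Fin 2) F)) = _
  rw [← Submodule.span_image, Set.image_singleton, Matrix.mulVecLin_apply]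

variable {F} in
/-- `g • [v] = [g v]`. [folklore] -/
theorem smul_line (g : GL (Fin 2) F) (v : Fin 2 → F) (hv : v ≠ 0) :
    g • line F v hv = line F ((g : Matrix (Fin 2) (Fin 2) F).mulVec v) (mulVec_ne_zero g hv) :=
  Subtype.ext (smul_line_val g v hv)

variable {F} in
/-- `g • ∞ = [first column of g]`. [folklore] -/
theorem smul_lineZero_val (g : GL (Fin 2) F) :
    (g • lineZero F).1 = F ∙ fun i => (g : Matrix (Fin 2) (Fin 2) F) i 0 := by
  rw [lineZero, smul_line_val, Matrix.mulVec_single_one]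
  rfl

variable {F} in
/-- A matrix of `GL₂(F)` with prescribed non-zero first column `v`: `(v₀ 0; v₁ 1)` if `v₀ ≠ 0`,
else `(0 1; v₁ 0)`. [folklore] -/
def glOfFirstColumn (v : Fin 2 → F) (hv : v ≠ 0) : GL (Fin 2) F :=
  if h0 : v 0 ≠ 0 then
    Matrix.GeneralLinearGroup.mkOfDetNeZero !![v 0, 0; v 1, 1] (by
      rw [Matrix.det_fin_two_of]; simpa using h0)
  else
    Matrix.GeneralLinearGroup.mkOfDetNeZero !![v 0, 1; v 1, 0] (by
      have h1 : v 1 ≠ 0 := fun h1 => hv (by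
        ext i; fin_cases i
        · exact not_not.1 h0
        · exact h1)
      rw [Matrix.det_fin_two_of]; simpa using h1)

variable {F} in
/-- The first column of `glOfFirstColumn v hv` is `v`. [folklore] -/
theorem glOfFirstColumn_apply_zero (v : Fin 2 → F) (hv : v ≠ 0) (i : Fin 2) :
    (glOfFirstColumn v hv : Matrix (Fin 2) (Fin 2) F) i 0 = v i := by
  unfold glOfFirstColumn
  split_ifs with h0
  · rw [Matrix.GeneralLinearGroup.val_mkOfDetNeZero]
    fin_cases i <;> simp
  · rw [Matrix.GeneralLinearGroup.val_mkOfDetNeZero]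
    fin_cases i <;> simp

variable {F} in
/-- `glOfFirstColumn v hv • ∞ = [v]`. [folklore] -/
theorem glOfFirstColumn_smul_lineZero (v : Fin 2 → F) (hv : v ≠ 0) :
    glOfFirstColumn v hv • lineZero F = line F v hv := by
  refine Subtype.ext ?_
  rw [smul_lineZero_val, line_val,
    show (fun i => (glOfFirstColumn v hv : Matrix (Fin 2) (Fin 2) F) i 0) = v from
      funext (glOfFirstColumn_apply_zero v hv)]

/-- **`GL₂(F)` acts transitively on `ℙ¹(F)`**: every vertex of the Tits building of `GL₂/F` is a
translate of `∞` (all proper `F`-parabolics of `GL₂` are conjugate to the standard Borel).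
[cite: Harder1987, §1] [cite: Schwermer2010, §6 (6.1)] -/
theorem exists_smul_lineZero_eq (W : ProperSubspace F 2) : ∃ g : GL (Fin 2) F, g • lineZero F = W := by
  obtain ⟨v, hv, rfl⟩ := exists_eq_line F W
  exact ⟨glOfFirstColumn v hv, glOfFirstColumn_smul_lineZero v hv⟩

/-! ### The stabiliser of `∞` is the Borel subgroup -/

variable {F} in
/-- **The stabiliser of `∞ = [e₀]` in `GL₂(F)` is the group of upper-triangular matrices**:
`g • ∞ = ∞ ↔ g₁₀ = 0`. [cite: Harder1987, §1] [cite: Schwermer2010, §6 (6.1)] -/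
theorem mem_stabilizer_lineZero_iff (g : GL (Fin 2) F) :
    g ∈ MulAction.stabilizer (GL (Fin 2) F) (lineZero F) ↔ (g : Matrix (Fin 2) (Fin 2) F) 1 0 = 0 := by
  rw [MulAction.mem_stabilizer_iff]
  constructor
  · intro h
    have h' : (fun i => (g : Matrix (Fin 2) (Fin 2) F) i 0) ∈ (lineZero F).1 := by
      rw [← h, smul_lineZero_val]
      exact Submodule.mem_span_singleton_self _
    rw [lineZero_val, Submodule.mem_span_singleton] at h'
    obtain ⟨a, ha⟩ := h'
    have := congrFun ha 1
    simpa using this.symm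
  · intro h
    refine properSubspace_two_eq_of_le F _ _ ?_
    change (g • lineZero F).1 ≤ (lineZero F).1
    rw [smul_lineZero_val, lineZero_val]
    refine (Submodule.span_singleton_le_iff_mem _ _).2 (Submodule.mem_span_singleton.2
      ⟨(g : Matrix (Fin 2) (Fin 2) F) 0 0, funext fun i => ?_⟩)
    fin_cases i
    · simp
    · simpa using h.symm

/-- **The standard Borel subgroup `B(F) ≤ GL₂(F)`**, defined as the stabiliser of `∞ ∈ ℙ¹(F)`
(`TwistedQuotient.vertexStabilizer`, the subgroup along which `BoundaryShapiro` restricts); by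
`mem_borel_iff` it is the group of upper-triangular invertible matrices. [cite: Harder1987, §1] -/
abbrev borel : Subgroup (GL (Fin 2) F) :=
  TwistedQuotient.vertexStabilizer (Γ := GL (Fin 2) F) (lineZero F)

variable {F} in
/-- `g ∈ B(F) ↔ g₁₀ = 0`. [cite: Harder1987, §1] -/
theorem mem_borel_iff (g : GL (Fin 2) F) : g ∈ borel F ↔ (g : Matrix (Fin 2) (Fin 2) F) 1 0 = 0 :=
  mem_stabilizer_lineZero_iff g

/-- **`B(F)` is the standard Borel subgroup** `standardParabolicGL F id` of the tree (block upper
triangular matrices for the identity labelling). [cite: Harder1987, §1] -/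
theorem borel_eq_standardParabolicGL : borel F = standardParabolicGL F (id : Fin 2 → Fin 2) := by
  ext g
  rw [mem_borel_iff, mem_standardParabolicGL_iff]
  constructor
  · intro h i j hij
    fin_cases i <;> fin_cases j
    · exact absurd hij (lt_irrefl _)
    · exact absurd hij (by decide)
    · exact h
    · exact absurd hij (lt_irrefl _)
  · intro h
    exact h (show (id 0 : Fin 2) < id 1 by decide)

/-- Diagonal matrices lie in the Borel subgroup. [folklore] -/
theorem glDiagonal_mem_borel (d : Fin 2 → Fˣ) : glDiagonal 2 F d ∈ borel F := by
  rw [mem_borel_iff, coe_glDiagonal, Matrix.diagonal_apply_ne _ (by decide)]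

/-- Scalar matrices lie in the Borel subgroup. [folklore] -/
theorem scalar_mem_borel (a : Fˣ) : Matrix.GeneralLinearGroup.scalar (Fin 2) a ∈ borel F := by
  rw [mem_borel_iff, Matrix.GeneralLinearGroup.coe_scalar, Matrix.scalar_apply,
    Matrix.diagonal_apply_ne _ (by decide)]

end Field

/-! ### The boundary cohomology of a `GL₂`-quotient is the cohomology of the Borel stratum -/

section Cohomology

universe u

variable (E : Type) [Field E] (F : Type) [Field F] (wt : Fin 2 → ℤ) [NumberField F]
  (U : Subgroup (BigHeckeGLn.FiniteAdelicGL 2 F))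

/-- **`H^q(∂X_U, Ṽ_wt) ≅ H^q(B(F), Fun(GL₂(𝔸_F^∞)/U, V_wt))`**: for `GL₂/F` the map
`TwistedQuotient.toStratumCohomology` at the vertex `∞` — restriction of the column-`0` boundary
cohomology `H^q(GL₂(F), Fun(ℙ¹(F) × GL₂(𝔸_F^∞)/U, V_wt))` to the `GL₂(F)`-orbit of `∞` followed by
Shapiro's isomorphism for `B(F) = Stab(∞) ≤ GL₂(F)` — is an ISOMORPHISM, because `GL₂(F)` is
transitive on `ℙ¹(F)` (`exists_smul_lineZero_eq`). [cite: Harder1987, §1] [cite: Schwermer2010, §6 (6.2)] -/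
theorem isIso_toStratumCohomology_lineZero (q : ℕ) :
    CategoryTheory.IsIso
      (TwistedQuotient.toStratumCohomology (V := CoeffModule E F 2 wt) (BigHeckeGLn.globalEmbedding 2 F)
        U (coeffRep E F 2 wt) (ProperSubspace F 2) (smul_properSubspace_mono F 2) (lineZero F) q) :=
  TwistedQuotient.isIso_toStratumCohomology _ _ _ _ _ _ (exists_smul_lineZero_eq F) q

end Cohomology

end ParallelWeight

end Literature.NumberTheory.Automorphic
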